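import Mathlib
import Summits.Ventures.PercRepro.TriangleCapLayerWitnessDefs

/-!
# PercRepro — THE LAYER WITNESS: THE COUNTS AND THE VALUE — EVERY BAND IS FULL (p3, gen 51; part 231)

For the missing graph `H` of `layerWitness n a r t u m` (part 230) at `w = 0`: `attach H 0 = m` (the `m` off-pairs
ending at a leaf each meet `N(0)` once, the others not at all) and `offAdjPairs H 0 = u (u − 1)` (only the `u`-star at
`a − 1` has intersecting pairs).  The vertex decomposition gives `Σ_H h² = (r − t)² + (r − t) + 2 t + 2 m + u (u − 1)`
and the bipartite spectrum the value of the witness: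

  **`Σ d² + r (n − 1 − r) + (2 t (r − t − 1) + 2 (t − m) + (t (t − 1) − u (u − 1))) = |E| · n`**   (`layerWitness_value`),

i.e. the gap `2 t (r − t − 1) + 2 j` with `j = (t − m) + (C(t, 2) − C(u, 2))`.  As `u` runs from `t` down to `0` the
term `C(t, 2) − C(u, 2)` climbs `0, t − 1, …, C(t, 2)` in steps `≤ t − 1`, and `t − m` fills each step: EVERY
`j ≤ t (t + 1) / 2` is attained (`layer_band_full`).  Hence (`cherry_band_full`, `t + 1 ≤ a`, `2 t ≤ r`,
`a + r ≤ n`, `r + 1 ≤ n`) every value `closed − (2 t (r − t − 1) + 2 j)` of the band `t` of the cherry table is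
attained by a `K₄⁻`-free graph, and (`pair_count_band_attained`) every band-`t` value `s (s + 1) − 2 t (s − t − 1) − 2 j`
of the pair-count spectrum is attained by a triangle-free graph with `s` edges on `s + t + 1` vertices.
Axioms: standard.
-/

namespace PercRepro

namespace TriangleCap

namespace C047

open Finset

/-- Two distinct off-pairs through one vertex `b` are both star pairs at `a − 1`, and `b` is the centre. -/
theorem mem_layerPair_unique (n a r t u m : ℕ) (hn : 0 < n) (ha : t + 1 ≤ a) (hr : t + m ≤ r) (han : a + r ≤ n)
    (i i' : ℕ) (hi : i < t) (hi' : i' < t) (hne : i ≠ i') (b : Fin n) (hb : b ∈ layerPair n a u m hn i)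
    (hb' : b ∈ layerPair n a u m hn i') : b.val = a - 1 ∧ i < u ∧ i' < u := by
  rw [mem_layerPair_iff n a r t u m hn i hi ha hr han] at hb
  rw [mem_layerPair_iff n a r t u m hn i' hi' ha hr han] at hb'
  have h1 := lEnd_lt a t u i hi ha
  have h2 := lEnd_lt a t u i' hi' ha
  have h3 := le_rEnd n a r t m i hi hr han
  have h4 := le_rEnd n a r t m i' hi' hr han
  rcases hb with hb | hb <;> rcases hb' with hb' | hb'
  · have := (lEnd_eq_iff a t u i i' hi hi' ha).mp (by omega)
    rcases this with h | ⟨hiu, hiu'⟩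
    · exact absurd h hne
    · refine ⟨?_, hiu, hiu'⟩
      rw [hb]
      unfold lEnd
      rw [if_pos hiu]
  · omega
  · omega
  · exact absurd (rEnd_inj n a r t m i i' hi hi' hr han (by omega)) hne

/-- The number of off-pairs through a vertex, as a count of indices. -/
theorem offDeg_layerWitness (n a r t u m : ℕ) (hn : 0 < n) (ha : t + 1 ≤ a) (hr : t + m ≤ r) (han : a + r ≤ n)
    (v : Fin n) :
    offDeg (missingGraph (layerWitness n a r t u m hn) (leftPart n a)) (fin' n hn 0) v =
      ((range t).filter (fun i => v ∈ layerPair n a u m hn i)).card := by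
  unfold offDeg
  rw [offEdges_missingGraph_layerWitness n a r t u m hn ha hr han]
  unfold layerPairs
  rw [filter_image, card_image_of_injOn]
  intro i hi i' hi' h
  simp only [coe_filter, mem_range, Set.mem_setOf_eq] at hi hi'
  exact (layerPair_eq_iff n a r t u m hn i i' hi.1 hi'.1 ha hr han).mp h

/-- At most one off-pair passes through a vertex other than the centre `a − 1`. -/
theorem offDeg_layerWitness_le_one (n a r t u m : ℕ) (hn : 0 < n) (ha : t + 1 ≤ a) (hr : t + m ≤ r)
    (han : a + r ≤ n) (v : Fin n) (hv : v.val ≠ a - 1 ∨ u = 0) :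
    offDeg (missingGraph (layerWitness n a r t u m hn) (leftPart n a)) (fin' n hn 0) v ≤ 1 := by
  rw [offDeg_layerWitness n a r t u m hn ha hr han]
  rw [card_le_one]
  intro i hi i' hi'
  simp only [mem_filter, mem_range] at hi hi'
  by_contra hne
  have := mem_layerPair_unique n a r t u m hn ha hr han i i' hi.1 hi'.1 hne v hi.2 hi'.2
  rcases hv with hv | hv
  · exact hv this.1
  · omega

/-- **`attach = m`:** exactly the `m` off-pairs ending at a leaf meet the neighbourhood of `0`. -/
theorem attach_layerWitness (n a r t u m : ℕ) (hn : 0 < n) (hm : m ≤ t) (ha : t + 1 ≤ a) (hr : t + m ≤ r)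
    (han : a + r ≤ n) :
    attach (missingGraph (layerWitness n a r t u m hn) (leftPart n a)) (fin' n hn 0) = m := by
  have hN := filter_adj_missingGraph_layerWitness n a r t u m hn ha hr han
  have hmem : ∀ v, (missingGraph (layerWitness n a r t u m hn) (leftPart n a)).Adj (fin' n hn 0) v ↔
      a ≤ v.val ∧ v.val < a + (r - t) := by
    intro v
    rw [Finset.ext_iff] at hN
    have := hN v
    simpa only [mem_filter, mem_univ, true_and, rightStar] using this
  rw [attach_eq_sum_card, offEdges_missingGraph_layerWitness n a r t u m hn ha hr han]
  unfold layerPairs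
  rw [sum_image (fun i hi i' hi' h => by
    simp only [coe_range, Set.mem_Iio] at hi hi'
    exact (layerPair_eq_iff n a r t u m hn i i' hi hi' ha hr han).mp h)]
  have hterm : ∀ i ∈ range t,
      (univ.filter (fun v => (missingGraph (layerWitness n a r t u m hn) (leftPart n a)).Adj (fin' n hn 0) v ∧
        v ∈ layerPair n a u m hn i)).card = if i < m then 1 else 0 := by
    intro i hi
    rw [mem_range] at hi
    have h1 := lEnd_lt a t u i hi ha
    have h2 := le_rEnd n a r t m i hi hr han
    have h3 := rEnd_lt_iff n a r t m i hi hr han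
    have h4 := rEnd_lt n a r t m i hi hr han
    by_cases him : i < m
    · rw [if_pos him]
      have : univ.filter (fun v => (missingGraph (layerWitness n a r t u m hn) (leftPart n a)).Adj (fin' n hn 0) v ∧
          v ∈ layerPair n a u m hn i) = {fin' n hn (rEnd n a m i)} := by
        ext v
        simp only [mem_filter, mem_univ, true_and, mem_singleton, hmem,
          mem_layerPair_iff n a r t u m hn i hi ha hr han, Fin.ext_iff, fin'_val n hn _ h4]
        omega
      rw [this, card_singleton]
    · rw [if_neg him]
      rw [card_eq_zero, filter_eq_empty_iff]
      intro v _
      simp only [hmem, mem_layerPair_iff n a r t u m hn i hi ha hr han]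
      omega
  rw [sum_congr rfl hterm, sum_boole, Nat.cast_id]
  have : (range t).filter (fun i => i < m) = range m := by
    ext i
    simp only [mem_filter, mem_range]
    omega
  rw [this, card_range]

/-- **`offAdjPairs = u (u − 1)`:** the only intersecting off-pairs are those of the `u`-star at `a − 1`. -/
theorem offAdjPairs_layerWitness (n a r t u m : ℕ) (hn : 0 < n) (ht : 1 ≤ t) (hu : u ≤ t) (ha : t + 1 ≤ a)
    (hr : t + m ≤ r) (han : a + r ≤ n) :
    offAdjPairs (missingGraph (layerWitness n a r t u m hn) (leftPart n a)) (fin' n hn 0) = u * (u - 1) := by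
  rw [← sum_erase_offDeg_mul_pred]
  have hcn : a - 1 < n := by omega
  have hc0 : fin' n hn (a - 1) ≠ fin' n hn 0 := by
    rw [Ne, Fin.ext_iff, fin'_val n hn _ hcn, fin'_val n hn 0 hn]
    omega
  rw [sum_eq_single_of_mem (fin' n hn (a - 1)) (mem_erase.mpr ⟨hc0, mem_univ _⟩)]
  · -- the centre
    rcases Nat.eq_zero_or_pos u with rfl | hupos
    · have := offDeg_layerWitness_le_one n a r t 0 m hn ha hr han (fin' n hn (a - 1)) (Or.inr rfl)
      rcases Nat.le_one_iff_eq_zero_or_eq_one.mp this with h | h <;> simp [h]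
    · rw [offDeg_layerWitness n a r t u m hn ha hr han]
      have : (range t).filter (fun i => fin' n hn (a - 1) ∈ layerPair n a u m hn i) = range u := by
        ext i
        simp only [mem_filter, mem_range]
        constructor
        · rintro ⟨hi, hmem⟩
          rw [mem_layerPair_iff n a r t u m hn i hi ha hr han, fin'_val n hn _ hcn] at hmem
          have h2 := le_rEnd n a r t m i hi hr han
          rcases hmem with h | h
          · unfold lEnd at h
            split_ifs at h with hiu
            · exact hiu
            · omega
          · omega
        · intro hi
          refine ⟨by omega, ?_⟩
          rw [mem_layerPair_iff n a r t u m hn i (by omega) ha hr han, fin'_val n hn _ hcn]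
          left
          unfold lEnd
          rw [if_pos hi]
      rw [this, card_range]
  · -- every other vertex carries at most one off-pair
    intro b hb hbc
    have hb' : b.val ≠ a - 1 := by
      intro h
      apply hbc
      rw [Fin.ext_iff, fin'_val n hn _ hcn]
      exact h
    have := offDeg_layerWitness_le_one n a r t u m hn ha hr han b (Or.inl hb')
    rcases Nat.le_one_iff_eq_zero_or_eq_one.mp this with h | h <;> simp [h]

/-- **THE VALUE OF THE LAYER WITNESS** (`1 ≤ t`, `u ≤ t`, `m ≤ t`, `t + 1 ≤ a`, `t + m ≤ r`, `t + 1 ≤ r`,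
`a + r ≤ n`, `r + 1 ≤ n`): `K₄⁻`-free, `|E| + r = a (n − a)`, and the gap to the closed form is
`2 t (r − t − 1) + 2 (t − m) + (t (t − 1) − u (u − 1))`. -/
theorem layerWitness_value (n a r t u m : ℕ) (ht : 1 ≤ t) (hu : u ≤ t) (hm : m ≤ t) (ha : t + 1 ≤ a)
    (hr : t + m ≤ r) (hr1 : t + 1 ≤ r) (han : a + r ≤ n) (hn : r + 1 ≤ n) :
    K4mFree (layerWitness n a r t u m (by omega)) ∧
      (layerWitness n a r t u m (by omega)).edgeFinset.card + r = a * (n - a) ∧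
      ∑ v, deg (layerWitness n a r t u m (by omega)) v * deg (layerWitness n a r t u m (by omega)) v +
          r * (n - 1 - r) + (2 * (t * (r - t - 1)) + (2 * (t - m) + (t * (t - 1) - u * (u - 1)))) =
        (layerWitness n a r t u m (by omega)).edgeFinset.card * n := by
  have hn0 : 0 < n := by omega
  have hE := card_edges_layerWitness n a r t u m hn0 ha hr han
  refine ⟨k4mFree_layerWitness n a r t u m hn0, hE, ?_⟩
  have hbs := bipSub_sum_deg_sq_add_disjEdgePairs (layerWitness n a r t u m hn0) (leftPart n a)
    (bipSub_layerWitness n a r t u m hn0) a r (card_leftPart n a (by omega))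
    (by rw [Fintype.card_fin]; exact hE) (by rw [Fintype.card_fin]; exact hn)
  rw [Fintype.card_fin] at hbs
  have hid := sum_deg_sq_add_disjEdgePairs (missingGraph (layerWitness n a r t u m hn0) (leftPart n a))
  rw [card_edges_missingGraph_layerWitness n a r t u m hn0 ha hr han] at hid
  have hdec := sum_deg_sq_vertex_decomposition (missingGraph (layerWitness n a r t u m hn0) (leftPart n a))
    (fin' n hn0 0)
  rw [deg_missingGraph_layerWitness_zero n a r t u m hn0 ha hr han,
    offEdges_missingGraph_layerWitness n a r t u m hn0 ha hr han, card_layerPairs n a r t u m hn0 ha hr han,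
    attach_layerWitness n a r t u m hn0 hm ha hr han, offAdjPairs_layerWitness n a r t u m hn0 ht hu ha hr han] at hdec
  have hQP : u * (u - 1) ≤ t * (t - 1) := Nat.mul_le_mul hu (Nat.sub_le_sub_right hu 1)
  have h1 : t ≤ r := by omega
  have h2 : 1 ≤ r - t := by omega
  rcases Nat.eq_zero_or_pos u with rfl | hupos
  · simp only [zero_mul, Nat.sub_zero] at hdec ⊢
    zify [h1, h2, hm, ht] at hbs hid hdec ⊢
    linear_combination hbs - hid + hdec
  · zify [h1, h2, hm, ht, hupos, hQP] at hbs hid hdec ⊢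
    linear_combination hbs - hid + hdec

/-- `(u + 1) u = u (u − 1) + 2 u`. -/
theorem succ_mul_self_eq (u : ℕ) : (u + 1) * u = u * (u - 1) + 2 * u := by
  rcases u with _ | u
  · rfl
  · rw [Nat.add_sub_cancel]
    ring

/-- **THE STAIRCASE:** for `k ≤ t` every `j` with `2 j ≤ 2 t + (t (t − 1) − (t − k)(t − k − 1))` is
`(t − m) + (C(t, 2) − C(u, 2))` for some `t − k ≤ u ≤ t` and `m ≤ t`. -/
theorem band_stair (t : ℕ) (ht : 1 ≤ t) : ∀ k, k ≤ t → ∀ j,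
    2 * j ≤ 2 * t + (t * (t - 1) - (t - k) * (t - k - 1)) →
    ∃ u, t - k ≤ u ∧ u ≤ t ∧ ∃ m, m ≤ t ∧ 2 * j = 2 * (t - m) + (t * (t - 1) - u * (u - 1)) := by
  intro k
  induction k with
  | zero =>
    intro _ j hj
    rw [Nat.sub_zero, Nat.sub_self] at hj
    refine ⟨t, by omega, le_rfl, t - j, by omega, ?_⟩
    rw [Nat.sub_self]
    omega
  | succ k ih =>
    intro hk j hj
    obtain ⟨u₀, hu₀⟩ : ∃ u₀, t = u₀ + k + 1 := ⟨t - k - 1, by omega⟩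
    have e1 : t - (k + 1) = u₀ := by omega
    have e2 : t - k = u₀ + 1 := by omega
    have e3 : u₀ + 1 - 1 = u₀ := by omega
    rw [e1] at hj ⊢
    have hQ1 : (u₀ + 1) * u₀ = u₀ * (u₀ - 1) + 2 * u₀ := succ_mul_self_eq u₀
    have hQP : u₀ * (u₀ - 1) ≤ t * (t - 1) := Nat.mul_le_mul (by omega) (by omega)
    have hQ1P : (u₀ + 1) * u₀ ≤ t * (t - 1) := Nat.mul_le_mul (by omega) (by omega)
    obtain ⟨p, hp⟩ := Nat.even_mul_pred_self t
    obtain ⟨q, hq⟩ := Nat.even_mul_pred_self u₀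
    by_cases hcase : 2 * j ≤ 2 * t + (t * (t - 1) - (t - k) * (t - k - 1))
    · obtain ⟨u, hu1, hu2, m, hm, hjm⟩ := ih (by omega) j hcase
      exact ⟨u, by omega, hu2, m, hm, hjm⟩
    · rw [e2, e3, hQ1] at hcase
      refine ⟨u₀, le_rfl, by omega, t + p - q - j, by omega, ?_⟩
      omega

/-- **EVERY BAND IS FULL:** for `1 ≤ t` and `2 j ≤ t (t + 1)`, `j = (t − m) + (C(t, 2) − C(u, 2))` for some
`u ≤ t` and `m ≤ t`. -/
theorem layer_band_full (t j : ℕ) (ht : 1 ≤ t) (hj : 2 * j ≤ t * (t + 1)) :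
    ∃ u, u ≤ t ∧ ∃ m, m ≤ t ∧ 2 * j = 2 * (t - m) + (t * (t - 1) - u * (u - 1)) := by
  have h := band_stair t ht t le_rfl j (by
    rw [Nat.sub_self, Nat.zero_sub, zero_mul, Nat.sub_zero]
    obtain ⟨t', rfl⟩ : ∃ t', t = t' + 1 := ⟨t - 1, by omega⟩
    rw [Nat.add_sub_cancel]
    nlinarith)
  obtain ⟨u, -, hu, m, hm, hjm⟩ := h
  exact ⟨u, hu, m, hm, hjm⟩

/-- **EVERY VALUE OF EVERY BAND OF THE CHERRY TABLE IS ATTAINED** (`1 ≤ t`, `t + 1 ≤ a`, `2 t ≤ r`, `a + r ≤ n`,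
`r + 1 ≤ n`, `2 j ≤ t (t + 1)`): a `K₄⁻`-free graph on `Fin n` with `|E| + r = a (n − a)` at the gap
`2 t (r − t − 1) + 2 j`. -/
theorem cherry_band_full (n a r t : ℕ) (ht : 1 ≤ t) (ha : t + 1 ≤ a) (hr : 2 * t ≤ r) (han : a + r ≤ n)
    (hn : r + 1 ≤ n) (j : ℕ) (hj : 2 * j ≤ t * (t + 1)) :
    ∃ (D : SimpleGraph (Fin n)) (_ : DecidableRel D.Adj), K4mFree D ∧ D.edgeFinset.card + r = a * (n - a) ∧
      ∑ v, deg D v * deg D v + r * (n - 1 - r) + (2 * (t * (r - t - 1)) + 2 * j) = D.edgeFinset.card * n := by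
  obtain ⟨u, hu, m, hm, hjm⟩ := layer_band_full t j ht hj
  obtain ⟨hK, hE, hS⟩ := layerWitness_value n a r t u m ht hu hm ha (by omega) (by omega) han hn
  refine ⟨layerWitness n a r t u m (by omega), inferInstance, hK, hE, ?_⟩
  rw [hjm]
  exact hS

/-- **EVERY BAND VALUE OF THE PAIR-COUNT SPECTRUM IS ATTAINED** (`1 ≤ t`, `2 t ≤ s`, `2 j ≤ t (t + 1)`): a
triangle-free graph with `s` edges on `s + t + 1` vertices and `Σ d² + 2 t (s − t − 1) + 2 j = s (s + 1)`. -/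
theorem pair_count_band_attained (s t j : ℕ) (ht : 1 ≤ t) (hs : 2 * t ≤ s) (hj : 2 * j ≤ t * (t + 1)) :
    ∃ (H : SimpleGraph (Fin (s + t + 1))) (_ : DecidableRel H.Adj), H.CliqueFree 3 ∧ H.edgeFinset.card = s ∧
      ∑ v, deg H v * deg H v + 2 * (t * (s - t - 1)) + 2 * j = s * (s + 1) := by
  obtain ⟨u, hu, m, hm, hjm⟩ := layer_band_full t j ht hj
  have hn0 : 0 < s + t + 1 := by omega
  have ha : t + 1 ≤ t + 1 := le_rfl
  have hr : t + m ≤ s := by omega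
  have han : t + 1 + s ≤ s + t + 1 := by omega
  refine ⟨missingGraph (layerWitness (s + t + 1) (t + 1) s t u m hn0) (leftPart (s + t + 1) (t + 1)),
    inferInstance, cliqueFree_of_bipSub _ _ (bipSub_missingGraph _ _),
    card_edges_missingGraph_layerWitness (s + t + 1) (t + 1) s t u m hn0 ha hr han, ?_⟩
  have hdec := sum_deg_sq_vertex_decomposition
    (missingGraph (layerWitness (s + t + 1) (t + 1) s t u m hn0) (leftPart (s + t + 1) (t + 1))) (fin' _ hn0 0)
  rw [deg_missingGraph_layerWitness_zero (s + t + 1) (t + 1) s t u m hn0 ha hr han,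
    offEdges_missingGraph_layerWitness (s + t + 1) (t + 1) s t u m hn0 ha hr han,
    card_layerPairs (s + t + 1) (t + 1) s t u m hn0 ha hr han,
    attach_layerWitness (s + t + 1) (t + 1) s t u m hn0 hm ha hr han,
    offAdjPairs_layerWitness (s + t + 1) (t + 1) s t u m hn0 ht hu ha hr han] at hdec
  rw [hdec]
  have hQP : u * (u - 1) ≤ t * (t - 1) := Nat.mul_le_mul hu (Nat.sub_le_sub_right hu 1)
  have h1 : t ≤ s := by omega
  have h2 : 1 ≤ s - t := by omega
  rcases Nat.eq_zero_or_pos u with rfl | hupos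
  · simp only [zero_mul, Nat.sub_zero] at hjm ⊢
    zify [h1, h2, hm, ht] at hjm ⊢
    linear_combination hjm
  · zify [h1, h2, hm, ht, hupos, hQP] at hjm ⊢
    linear_combination hjm

end C047

end TriangleCap

end PercRepro
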